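import Summits.AtomisticToContinuum.Crystallization.Theorems.ChargedEnergyGapConvexPieces
import HarnessLib

/-!
# NODE 80-SWEEP part A «ConvexPieces / seams + octahedral level» — the primed q-cascade statements (item 14231, critic row 1434 R1c)

The tree's seam-level statements (H-q) `LocalSeamTransferBoundQ`, [LOAD-q], [COER-q], [BAR♮-q], [GEO♮-q], [STIFF-q], [MID-q], [FAR-q]
(`…QuantisedSeamsA` §Q2) and the octahedral (K₁ᴴ) `OctShellHQ`, (Λ) `OctDefLedgerQ` bind `∀ m D σ` under the sole list hypothesis
`∀ i, IsInvariantSet P (D i)`.  This module files their PRIMED versions — tree text VERBATIM with the one binder `(∀ i, IsConvexPieces (2 * ϱχ) (D i)) →`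
inserted right after it (repair of record R1c, pilot `…ConvexPieces`) — with (a) the weakenings «unprimed ⇒ primed», (b) every tree glue re-proved
with the binder threaded (the glues are parametric in `(D, σ)`: no list is transformed), (c) the fcc / hcp q-designates.  Pieces PROVED or TRUE for
every list — (L) `OctLedgerQ` (identity), (K₀) `OctPlateauQ`, (C) `OctCollarQ`, (Δ) `OctDictQ` (proved designates) — are used UNPRIMED.

0 sorry · standard axioms · no instance / notation / private / set_option.
-/

noncomputable section

open scoped Classical
open Literature.MathematicalPhysics.StatisticalMechanics Literature.Geometry.DiscreteGeometry
open Summit.AtomisticToContinuum.Crystallization.Theses.PricedLinkCensus Summit.AtomisticToContinuum.Crystallization.Theorems.ChargedEnergyGapNegative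

namespace Summit.AtomisticToContinuum.Crystallization.Theorems.ChargedEnergyGapChartDial

/-! ## §A1 The primed seam-level pieces over the quantised block -/

section PiecesPrimed

variable (cls : Set E3 → Prop) (s lam ℓ μ₀ τ lamQ ϱ b₀ r_S b₁ ϱχ r₁ r₂ : ℝ)

/-- (H-q)′ · `LocalSeamTransferBoundQ` over ADMISSIBLE cut lists (binder `∀ i, IsConvexPieces (2ϱχ) (D i)`).  WEAKER than (H-q).  [residual side ·
UNDECIDED → TRUE-leaning at the designate (census g76: admissible half-space cuts, worst `0.859`); the unprimed (H-q) is false-leaning as typed by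
RIDGE-79 through (KX)] -/
def LocalSeamTransferBoundQ' (C_T Cχ : ℝ) : Prop :=
  ∃ C_H : ℝ, 0 ≤ C_H ∧ ∀ (P : PeriodicConfiguration 3) (C X : Set E3) (β₀ : E3 → E3 → E3) (k : ℕ) (S : Fin k → CutPiece)
    (m : ℕ) (D : Fin m → Set E3) (σ : Fin m → Bool),
    IsSeparatedRef s P → IsLabelledRef lam ℓ P → cls P.points → IsForceFree P → IsSiteStressFree P → HarmStableModRot μ₀ P →
    IsInvariantSet P C → IsInvariantSet P X → IsGlobalCocycle P β₀ → IsSeamSystem b₀ r_S P S → IsQuantisedSeams b₁ S →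
    SmallStrain τ P X (volterraField P S β₀) → (∀ i, IsInvariantSet P (D i)) → (∀ i, IsConvexPieces (2 * ϱχ) (D i)) →
      -(C_T * shellMassL ϱχ D σ P X ϱ C) - Cχ * transMassL ϱχ D σ P X ϱ C - C_H * (pricedNearCountL ϱχ D σ P X ϱ C : ℝ) ≤
        modelFarL ϱχ D σ (volterraField P S β₀) P X lamQ ϱ C

/-- [LOAD-q]′ · `LoadBoundQ` over admissible cut lists.  WEAKER than [LOAD-q]. -/
def LoadBoundQ' (t A_T Aχ : ℝ) : Prop :=
  ∃ A_H : ℝ, 0 ≤ A_H ∧ ∀ (P : PeriodicConfiguration 3) (C X : Set E3) (β₀ : E3 → E3 → E3) (k : ℕ) (S : Fin k → CutPiece)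
    (m : ℕ) (D : Fin m → Set E3) (σ : Fin m → Bool),
    IsSeparatedRef s P → IsLabelledRef lam ℓ P → cls P.points → IsForceFree P → IsSiteStressFree P → HarmStableModRot μ₀ P →
    IsInvariantSet P C → IsInvariantSet P X → IsGlobalCocycle P β₀ → IsSeamSystem b₀ r_S P S → IsQuantisedSeams b₁ S →
    SmallStrain τ P X (volterraField P S β₀) → (∀ i, IsInvariantSet P (D i)) → (∀ i, IsConvexPieces (2 * ϱχ) (D i)) →
      -(A_T * shellMassL ϱχ D σ P X ϱ C) - Aχ * transMassL ϱχ D σ P X ϱ C - A_H * (pricedNearCountL ϱχ D σ P X ϱ C : ℝ) ≤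
        loadL ϱχ D σ (volterraField P S β₀) P X ϱ C + t * springL ϱχ D σ (volterraField P S β₀) P X r₁ ϱ C

/-- [COER-q]′ · `CoerciveStiffQ` over admissible cut lists.  WEAKER than [COER-q]; glued below from [BAR♮-q]′ ∧ [GEO♮-q]′. -/
def CoerciveStiffQ' (μ c_T cχ : ℝ) : Prop :=
  ∃ c_H : ℝ, 0 ≤ c_H ∧ ∀ (P : PeriodicConfiguration 3) (C X : Set E3) (β₀ : E3 → E3 → E3) (k : ℕ) (S : Fin k → CutPiece)
    (m : ℕ) (D : Fin m → Set E3) (σ : Fin m → Bool),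
    IsSeparatedRef s P → IsLabelledRef lam ℓ P → cls P.points → IsForceFree P → IsSiteStressFree P → HarmStableModRot μ₀ P →
    IsInvariantSet P C → IsInvariantSet P X → IsGlobalCocycle P β₀ → IsSeamSystem b₀ r_S P S → IsQuantisedSeams b₁ S →
    SmallStrain τ P X (volterraField P S β₀) → (∀ i, IsInvariantSet P (D i)) → (∀ i, IsConvexPieces (2 * ϱχ) (D i)) →
      μ * springL ϱχ D σ (volterraField P S β₀) P X r₁ ϱ C - c_T * shellMassL ϱχ D σ P X ϱ C - cχ * transMassL ϱχ D σ P X ϱ C -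
          c_H * (pricedNearCountL ϱχ D σ P X ϱ C : ℝ) ≤
        stiffL ϱχ D σ (volterraField P S β₀) P X ϱ C

/-- [BAR♮-q]′ · `BarExchQ` over admissible cut lists.  WEAKER than [BAR♮-q]; glued below from [STIFF-q]′ ∧ [MID-q]′ ∧ [FAR-q]′. -/
def BarExchQ' (μ₁ η c_T cχ : ℝ) : Prop :=
  ∃ c_H : ℝ, 0 ≤ c_H ∧ ∀ (P : PeriodicConfiguration 3) (C X : Set E3) (β₀ : E3 → E3 → E3) (k : ℕ) (S : Fin k → CutPiece)
    (m : ℕ) (D : Fin m → Set E3) (σ : Fin m → Bool),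
    IsSeparatedRef s P → IsLabelledRef lam ℓ P → cls P.points → IsForceFree P → IsSiteStressFree P → HarmStableModRot μ₀ P →
    IsInvariantSet P C → IsInvariantSet P X → IsGlobalCocycle P β₀ → IsSeamSystem b₀ r_S P S → IsQuantisedSeams b₁ S →
    SmallStrain τ P X (volterraField P S β₀) → (∀ i, IsInvariantSet P (D i)) → (∀ i, IsConvexPieces (2 * ϱχ) (D i)) →
      μ₁ * springL ϱχ D σ (volterraField P S β₀) P X r₁ ϱ C + η * nonAffL ϱχ D σ (volterraField P S β₀) P X r₁ ϱ C -
            c_T * shellMassL ϱχ D σ P X ϱ C - cχ * transMassL ϱχ D σ P X ϱ C -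
          c_H * (pricedNearCountL ϱχ D σ P X ϱ C : ℝ) ≤
        barL ϱχ D σ (volterraField P S β₀) P X ϱ C

/-- [GEO♮-q]′ · `GeoExchQ` over admissible cut lists.  WEAKER than [GEO♮-q]; a LEAF of the primed designate. -/
def GeoExchQ' (ν₀ η c_T cχ : ℝ) : Prop :=
  ∃ c_H : ℝ, 0 ≤ c_H ∧ ∀ (P : PeriodicConfiguration 3) (C X : Set E3) (β₀ : E3 → E3 → E3) (k : ℕ) (S : Fin k → CutPiece)
    (m : ℕ) (D : Fin m → Set E3) (σ : Fin m → Bool),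
    IsSeparatedRef s P → IsLabelledRef lam ℓ P → cls P.points → IsForceFree P → IsSiteStressFree P → HarmStableModRot μ₀ P →
    IsInvariantSet P C → IsInvariantSet P X → IsGlobalCocycle P β₀ → IsSeamSystem b₀ r_S P S → IsQuantisedSeams b₁ S →
    SmallStrain τ P X (volterraField P S β₀) → (∀ i, IsInvariantSet P (D i)) → (∀ i, IsConvexPieces (2 * ϱχ) (D i)) →
      -(ν₀ * springL ϱχ D σ (volterraField P S β₀) P X r₁ ϱ C) - η * nonAffL ϱχ D σ (volterraField P S β₀) P X r₁ ϱ C -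
            c_T * shellMassL ϱχ D σ P X ϱ C - cχ * transMassL ϱχ D σ P X ϱ C -
          c_H * (pricedNearCountL ϱχ D σ P X ϱ C : ℝ) ≤
        geoL ϱχ D σ (volterraField P S β₀) P X ϱ C

/-- [STIFF-q]′ · `NearStiffQ` over admissible cut lists.  WEAKER than [STIFF-q] ⟸ [NN-ᶜ] (field-free, landed). -/
def NearStiffQ' (κ_B : ℝ) : Prop :=
  ∀ (P : PeriodicConfiguration 3) (C X : Set E3) (β₀ : E3 → E3 → E3) (k : ℕ) (S : Fin k → CutPiece)
    (m : ℕ) (D : Fin m → Set E3) (σ : Fin m → Bool),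
    IsSeparatedRef s P → IsLabelledRef lam ℓ P → cls P.points → IsForceFree P → IsSiteStressFree P → HarmStableModRot μ₀ P →
    IsInvariantSet P C → IsInvariantSet P X → IsGlobalCocycle P β₀ → IsSeamSystem b₀ r_S P S → IsQuantisedSeams b₁ S →
    SmallStrain τ P X (volterraField P S β₀) → (∀ i, IsInvariantSet P (D i)) → (∀ i, IsConvexPieces (2 * ϱχ) (D i)) →
      κ_B * springL ϱχ D σ (volterraField P S β₀) P X r₁ ϱ C ≤ barNearL ϱχ D σ r₁ (volterraField P S β₀) P X ϱ C

/-- [MID-q]′ · `MidTrussQ` over admissible cut lists.  WEAKER than [MID-q]. -/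
def MidTrussQ' (κ₂ η₂ c_T cχ : ℝ) : Prop :=
  ∃ c_H : ℝ, 0 ≤ c_H ∧ ∀ (P : PeriodicConfiguration 3) (C X : Set E3) (β₀ : E3 → E3 → E3) (k : ℕ) (S : Fin k → CutPiece)
    (m : ℕ) (D : Fin m → Set E3) (σ : Fin m → Bool),
    IsSeparatedRef s P → IsLabelledRef lam ℓ P → cls P.points → IsForceFree P → IsSiteStressFree P → HarmStableModRot μ₀ P →
    IsInvariantSet P C → IsInvariantSet P X → IsGlobalCocycle P β₀ → IsSeamSystem b₀ r_S P S → IsQuantisedSeams b₁ S →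
    SmallStrain τ P X (volterraField P S β₀) → (∀ i, IsInvariantSet P (D i)) → (∀ i, IsConvexPieces (2 * ϱχ) (D i)) →
      -(κ₂ * springL ϱχ D σ (volterraField P S β₀) P X r₁ ϱ C) + η₂ * nonAffL ϱχ D σ (volterraField P S β₀) P X r₁ ϱ C -
            c_T * shellMassL ϱχ D σ P X ϱ C - cχ * transMassL ϱχ D σ P X ϱ C -
          c_H * (pricedNearCountL ϱχ D σ P X ϱ C : ℝ) ≤
        barMidL ϱχ D σ r₁ r₂ (volterraField P S β₀) P X ϱ C

/-- [FAR-q]′ · `FarTrussQ` over admissible cut lists.  WEAKER than [FAR-q]. -/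
def FarTrussQ' (κ₃ η₃ c_T cχ : ℝ) : Prop :=
  ∃ c_H : ℝ, 0 ≤ c_H ∧ ∀ (P : PeriodicConfiguration 3) (C X : Set E3) (β₀ : E3 → E3 → E3) (k : ℕ) (S : Fin k → CutPiece)
    (m : ℕ) (D : Fin m → Set E3) (σ : Fin m → Bool),
    IsSeparatedRef s P → IsLabelledRef lam ℓ P → cls P.points → IsForceFree P → IsSiteStressFree P → HarmStableModRot μ₀ P →
    IsInvariantSet P C → IsInvariantSet P X → IsGlobalCocycle P β₀ → IsSeamSystem b₀ r_S P S → IsQuantisedSeams b₁ S →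
    SmallStrain τ P X (volterraField P S β₀) → (∀ i, IsInvariantSet P (D i)) → (∀ i, IsConvexPieces (2 * ϱχ) (D i)) →
      -(κ₃ * springL ϱχ D σ (volterraField P S β₀) P X r₁ ϱ C) + η₃ * nonAffL ϱχ D σ (volterraField P S β₀) P X r₁ ϱ C -
            c_T * shellMassL ϱχ D σ P X ϱ C - cχ * transMassL ϱχ D σ P X ϱ C -
          c_H * (pricedNearCountL ϱχ D σ P X ϱ C : ℝ) ≤
        barFarL ϱχ D σ r₂ (volterraField P S β₀) P X ϱ C

/-- (K₁ᴴ)′ · `OctShellHQ` over admissible cut lists.  WEAKER than (K₁ᴴ). -/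
def OctShellHQ' (κ₂ c_T cχ : ℝ) : Prop :=
  ∃ c_H : ℝ, 0 ≤ c_H ∧ ∀ (P : PeriodicConfiguration 3) (C X : Set E3) (β₀ : E3 → E3 → E3) (k : ℕ) (S : Fin k → CutPiece)
    (m : ℕ) (D : Fin m → Set E3) (σ : Fin m → Bool),
    IsSeparatedRef s P → IsLabelledRef lam ℓ P → cls P.points → IsForceFree P → IsSiteStressFree P → HarmStableModRot μ₀ P →
    IsInvariantSet P C → IsInvariantSet P X → IsGlobalCocycle P β₀ → IsSeamSystem b₀ r_S P S → IsQuantisedSeams b₁ S →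
    SmallStrain τ P X (volterraField P S β₀) → (∀ i, IsInvariantSet P (D i)) → (∀ i, IsConvexPieces (2 * ϱχ) (D i)) →
      -(c_T * shellMassL ϱχ D σ P X ϱ C) - cχ * transMassL ϱχ D σ P X ϱ C - c_H * (pricedNearCountL ϱχ D σ P X ϱ C : ℝ) ≤
        octShellL ϱχ D σ κ₂ r₁ r₂ (volterraField P S β₀) P X ϱ C

/-- (Λ)′ · `OctDefLedgerQ` (the FIELD-FREE deficit ledger) over admissible cut lists.  WEAKER than (Λ). -/
def OctDefLedgerQ' (κ₂ ρlo ρhi c_T cχ : ℝ) : Prop :=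
  ∃ c_H : ℝ, 0 ≤ c_H ∧ ∀ (P : PeriodicConfiguration 3) (C X : Set E3) (m : ℕ) (D : Fin m → Set E3) (σ : Fin m → Bool),
    IsSeparatedRef s P → IsLabelledRef lam ℓ P → cls P.points → IsForceFree P → IsSiteStressFree P →
    IsInvariantSet P C → IsInvariantSet P X → (∀ i, IsInvariantSet P (D i)) → (∀ i, IsConvexPieces (2 * ϱχ) (D i)) →
    IsFramedOct P r₁ r₂ ρlo ρhi →
      octDefShellL ϱχ D σ κ₂ r₁ r₂ τ P X ϱ C ≤
        c_T * shellMassL ϱχ D σ P X ϱ C + cχ * transMassL ϱχ D σ P X ϱ C + c_H * (pricedNearCountL ϱχ D σ P X ϱ C : ℝ)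

end PiecesPrimed

/-! ## §A2 Unprimed ⇒ primed (PROVED: the binder is dropped) -/

section WeakerPrimed

variable {cls : Set E3 → Prop} {s lam ℓ μ₀ τ lamQ ϱ b₀ r_S b₁ ϱχ r₁ r₂ : ℝ}

/-- (H-q) ⟹ (H-q)′: the unprimed bound specialises to admissible lists (the binder is dropped). -/
theorem localSeamTransferBoundQ'_of_localSeamTransferBoundQ {C_T Cχ : ℝ}
    (h : LocalSeamTransferBoundQ cls s lam ℓ μ₀ τ lamQ ϱ b₀ r_S b₁ ϱχ C_T Cχ) :
    LocalSeamTransferBoundQ' cls s lam ℓ μ₀ τ lamQ ϱ b₀ r_S b₁ ϱχ C_T Cχ := by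
  obtain ⟨c, hc, h⟩ := h
  exact ⟨c, hc, fun P C X β₀ k S m D σ h1 h2 hcl h3 h4 h5 h6 h7 h8 h9 hq h10 h11 _ =>
    h P C X β₀ k S m D σ h1 h2 hcl h3 h4 h5 h6 h7 h8 h9 hq h10 h11⟩

/-- [LOAD-q] ⟹ [LOAD-q]′ (the binder is dropped). -/
theorem loadBoundQ'_of_loadBoundQ {t A_T Aχ : ℝ} (h : LoadBoundQ cls s lam ℓ μ₀ τ ϱ b₀ r_S b₁ ϱχ r₁ t A_T Aχ) :
    LoadBoundQ' cls s lam ℓ μ₀ τ ϱ b₀ r_S b₁ ϱχ r₁ t A_T Aχ := by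
  obtain ⟨c, hc, h⟩ := h
  exact ⟨c, hc, fun P C X β₀ k S m D σ h1 h2 hcl h3 h4 h5 h6 h7 h8 h9 hq h10 h11 _ =>
    h P C X β₀ k S m D σ h1 h2 hcl h3 h4 h5 h6 h7 h8 h9 hq h10 h11⟩

/-- [COER-q] ⟹ [COER-q]′ (the binder is dropped). -/
theorem coerciveStiffQ'_of_coerciveStiffQ {μ c_T cχ : ℝ} (h : CoerciveStiffQ cls s lam ℓ μ₀ τ ϱ b₀ r_S b₁ ϱχ r₁ μ c_T cχ) :
    CoerciveStiffQ' cls s lam ℓ μ₀ τ ϱ b₀ r_S b₁ ϱχ r₁ μ c_T cχ := by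
  obtain ⟨c, hc, h⟩ := h
  exact ⟨c, hc, fun P C X β₀ k S m D σ h1 h2 hcl h3 h4 h5 h6 h7 h8 h9 hq h10 h11 _ =>
    h P C X β₀ k S m D σ h1 h2 hcl h3 h4 h5 h6 h7 h8 h9 hq h10 h11⟩

/-- [BAR♮-q] ⟹ [BAR♮-q]′ (the binder is dropped). -/
theorem barExchQ'_of_barExchQ {μ₁ η c_T cχ : ℝ} (h : BarExchQ cls s lam ℓ μ₀ τ ϱ b₀ r_S b₁ ϱχ r₁ μ₁ η c_T cχ) :
    BarExchQ' cls s lam ℓ μ₀ τ ϱ b₀ r_S b₁ ϱχ r₁ μ₁ η c_T cχ := by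
  obtain ⟨c, hc, h⟩ := h
  exact ⟨c, hc, fun P C X β₀ k S m D σ h1 h2 hcl h3 h4 h5 h6 h7 h8 h9 hq h10 h11 _ =>
    h P C X β₀ k S m D σ h1 h2 hcl h3 h4 h5 h6 h7 h8 h9 hq h10 h11⟩

/-- [GEO♮-q] ⟹ [GEO♮-q]′ (the binder is dropped). -/
theorem geoExchQ'_of_geoExchQ {ν₀ η c_T cχ : ℝ} (h : GeoExchQ cls s lam ℓ μ₀ τ ϱ b₀ r_S b₁ ϱχ r₁ ν₀ η c_T cχ) :
    GeoExchQ' cls s lam ℓ μ₀ τ ϱ b₀ r_S b₁ ϱχ r₁ ν₀ η c_T cχ := by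
  obtain ⟨c, hc, h⟩ := h
  exact ⟨c, hc, fun P C X β₀ k S m D σ h1 h2 hcl h3 h4 h5 h6 h7 h8 h9 hq h10 h11 _ =>
    h P C X β₀ k S m D σ h1 h2 hcl h3 h4 h5 h6 h7 h8 h9 hq h10 h11⟩

/-- [STIFF-q] ⟹ [STIFF-q]′ (the binder is dropped). -/
theorem nearStiffQ'_of_nearStiffQ {κ_B : ℝ} (h : NearStiffQ cls s lam ℓ μ₀ τ ϱ b₀ r_S b₁ ϱχ r₁ κ_B) :
    NearStiffQ' cls s lam ℓ μ₀ τ ϱ b₀ r_S b₁ ϱχ r₁ κ_B :=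
  fun P C X β₀ k S m D σ h1 h2 hcl h3 h4 h5 h6 h7 h8 h9 hq h10 h11 _ =>
    h P C X β₀ k S m D σ h1 h2 hcl h3 h4 h5 h6 h7 h8 h9 hq h10 h11

/-- [NN-ᶜ](`κ_B ≥ 0`) (field-free, landed shape) ⟹ [STIFF-q]′, through the tree's `nearStiffQ_of_nnStiff`. -/
theorem nearStiffQ'_of_nnStiff {κ_B : ℝ} (hκ : 0 ≤ κ_B) (h : NnStiffCls cls κ_B r₁) :
    NearStiffQ' cls s lam ℓ μ₀ τ ϱ b₀ r_S b₁ ϱχ r₁ κ_B :=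
  nearStiffQ'_of_nearStiffQ (nearStiffQ_of_nnStiff b₁ hκ h)

/-- [MID-q] ⟹ [MID-q]′ (the binder is dropped). -/
theorem midTrussQ'_of_midTrussQ {κ₂ η₂ c_T cχ : ℝ} (h : MidTrussQ cls s lam ℓ μ₀ τ ϱ b₀ r_S b₁ ϱχ r₁ r₂ κ₂ η₂ c_T cχ) :
    MidTrussQ' cls s lam ℓ μ₀ τ ϱ b₀ r_S b₁ ϱχ r₁ r₂ κ₂ η₂ c_T cχ := by
  obtain ⟨c, hc, h⟩ := h
  exact ⟨c, hc, fun P C X β₀ k S m D σ h1 h2 hcl h3 h4 h5 h6 h7 h8 h9 hq h10 h11 _ =>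
    h P C X β₀ k S m D σ h1 h2 hcl h3 h4 h5 h6 h7 h8 h9 hq h10 h11⟩

/-- [FAR-q] ⟹ [FAR-q]′ (the binder is dropped). -/
theorem farTrussQ'_of_farTrussQ {κ₃ η₃ c_T cχ : ℝ} (h : FarTrussQ cls s lam ℓ μ₀ τ ϱ b₀ r_S b₁ ϱχ r₁ r₂ κ₃ η₃ c_T cχ) :
    FarTrussQ' cls s lam ℓ μ₀ τ ϱ b₀ r_S b₁ ϱχ r₁ r₂ κ₃ η₃ c_T cχ := by
  obtain ⟨c, hc, h⟩ := h
  exact ⟨c, hc, fun P C X β₀ k S m D σ h1 h2 hcl h3 h4 h5 h6 h7 h8 h9 hq h10 h11 _ =>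
    h P C X β₀ k S m D σ h1 h2 hcl h3 h4 h5 h6 h7 h8 h9 hq h10 h11⟩

/-- (K₁ᴴ) ⟹ (K₁ᴴ)′ (the binder is dropped). -/
theorem octShellHQ'_of_octShellHQ {κ₂ c_T cχ : ℝ} (h : OctShellHQ cls s lam ℓ μ₀ τ ϱ b₀ r_S b₁ ϱχ r₁ r₂ κ₂ c_T cχ) :
    OctShellHQ' cls s lam ℓ μ₀ τ ϱ b₀ r_S b₁ ϱχ r₁ r₂ κ₂ c_T cχ := by
  obtain ⟨c, hc, h⟩ := h
  exact ⟨c, hc, fun P C X β₀ k S m D σ h1 h2 hcl h3 h4 h5 h6 h7 h8 h9 hq h10 h11 _ =>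
    h P C X β₀ k S m D σ h1 h2 hcl h3 h4 h5 h6 h7 h8 h9 hq h10 h11⟩

/-- (Λ) ⟹ (Λ)′ (the binder is dropped). -/
theorem octDefLedgerQ'_of_octDefLedgerQ {κ₂ ρlo ρhi c_T cχ : ℝ} (h : OctDefLedgerQ cls s lam ℓ τ ϱ ϱχ r₁ r₂ κ₂ ρlo ρhi c_T cχ) :
    OctDefLedgerQ' cls s lam ℓ τ ϱ ϱχ r₁ r₂ κ₂ ρlo ρhi c_T cχ := by
  obtain ⟨c, hc, h⟩ := h
  exact ⟨c, hc, fun P C X m D σ h1 h2 hcl h3 h4 h6 h7 h11 _ hFr => h P C X m D σ h1 h2 hcl h3 h4 h6 h7 h11 hFr⟩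

end WeakerPrimed

/-! ## §A3 The seam-level glue re-threaded through admissible lists (PROVED) -/

section GluePrimed

variable {cls : Set E3 → Prop} {s lam ℓ μ₀ τ lamQ ϱ b₀ r_S b₁ ϱχ r₁ r₂ : ℝ}

/-- ★ GLUE [STIFF-q]′ ∧ [MID-q]′ ∧ [FAR-q]′ ⟹ [BAR♮-q]′ (`r₁ ≤ r₂`; constants as in the tree glue). -/
theorem barExchQ'_of_nearStiff_of_midTruss_of_farTruss {κ_B κ₂ κ₃ η₂ η₃ c₂ cχ₂ c₃ cχ₃ : ℝ} (hr : r₁ ≤ r₂)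
    (hN : NearStiffQ' cls s lam ℓ μ₀ τ ϱ b₀ r_S b₁ ϱχ r₁ κ_B) (hM : MidTrussQ' cls s lam ℓ μ₀ τ ϱ b₀ r_S b₁ ϱχ r₁ r₂ κ₂ η₂ c₂ cχ₂)
    (hF : FarTrussQ' cls s lam ℓ μ₀ τ ϱ b₀ r_S b₁ ϱχ r₁ r₂ κ₃ η₃ c₃ cχ₃) :
    BarExchQ' cls s lam ℓ μ₀ τ ϱ b₀ r_S b₁ ϱχ r₁ (κ_B - κ₂ - κ₃) (η₂ + η₃) (c₂ + c₃) (cχ₂ + cχ₃) := by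
  obtain ⟨m_H, hm, hM⟩ := hM
  obtain ⟨f_H, hf, hF⟩ := hF
  refine ⟨m_H + f_H, add_nonneg hm hf, fun P C X β₀ k S m D σ h1 h2 hcl h3 h4 h5 h6 h7 h8 h9 hq h10 h11 hcv => ?_⟩
  have H0 := hN P C X β₀ k S m D σ h1 h2 hcl h3 h4 h5 h6 h7 h8 h9 hq h10 h11 hcv
  have H1 := hM P C X β₀ k S m D σ h1 h2 hcl h3 h4 h5 h6 h7 h8 h9 hq h10 h11 hcv
  have H2 := hF P C X β₀ k S m D σ h1 h2 hcl h3 h4 h5 h6 h7 h8 h9 hq h10 h11 hcv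
  rw [barL_eq_barNearL_add_barMidL_add_barFarL (ϱχ := ϱχ) (D := D) (σ := σ) hr h10 ϱ C]
  linear_combination H0 + H1 + H2

/-- ★ GLUE [BAR♮-q]′ ∧ [GEO♮-q]′ ⟹ [COER-q]′. -/
theorem coerciveStiffQ'_of_barExch_of_geoExch {μ₁ ν₀ η c₁ cχ₁ c₂ cχ₂ : ℝ}
    (hB : BarExchQ' cls s lam ℓ μ₀ τ ϱ b₀ r_S b₁ ϱχ r₁ μ₁ η c₁ cχ₁) (hG : GeoExchQ' cls s lam ℓ μ₀ τ ϱ b₀ r_S b₁ ϱχ r₁ ν₀ η c₂ cχ₂) :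
    CoerciveStiffQ' cls s lam ℓ μ₀ τ ϱ b₀ r_S b₁ ϱχ r₁ (μ₁ - ν₀) (c₁ + c₂) (cχ₁ + cχ₂) := by
  obtain ⟨b_H, hb, hB⟩ := hB
  obtain ⟨g_H, hg, hG⟩ := hG
  refine ⟨b_H + g_H, add_nonneg hb hg, fun P C X β₀ k S m D σ h1 h2 hcl h3 h4 h5 h6 h7 h8 h9 hq h10 h11 hcv => ?_⟩
  have H1 := hB P C X β₀ k S m D σ h1 h2 hcl h3 h4 h5 h6 h7 h8 h9 hq h10 h11 hcv
  have H2 := hG P C X β₀ k S m D σ h1 h2 hcl h3 h4 h5 h6 h7 h8 h9 hq h10 h11 hcv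
  rw [stiffL_eq_barL_add_geoL h10]
  linear_combination H1 + H2

/-- ★ GLUE [LOAD-q]′ ∧ [COER-q]′ ⟹ (H-q)′ (`0 ≤ λ`). -/
theorem localSeamTransferBoundQ'_of_load_of_coercive {μ A_T Aχ c_T cχ : ℝ} (hlam : 0 ≤ lamQ)
    (hL : LoadBoundQ' cls s lam ℓ μ₀ τ ϱ b₀ r_S b₁ ϱχ r₁ (lamQ * μ) A_T Aχ)
    (hK : CoerciveStiffQ' cls s lam ℓ μ₀ τ ϱ b₀ r_S b₁ ϱχ r₁ μ c_T cχ) :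
    LocalSeamTransferBoundQ' cls s lam ℓ μ₀ τ lamQ ϱ b₀ r_S b₁ ϱχ (A_T + lamQ * c_T) (Aχ + lamQ * cχ) := by
  obtain ⟨A_H, hA, hL⟩ := hL
  obtain ⟨c_H, hc, hK⟩ := hK
  refine ⟨A_H + lamQ * c_H, by positivity, fun P C X β₀ k S m D σ h1 h2 hcl h3 h4 h5 h6 h7 h8 h9 hq h10 h11 hcv => ?_⟩
  have H1 := hL P C X β₀ k S m D σ h1 h2 hcl h3 h4 h5 h6 h7 h8 h9 hq h10 h11 hcv
  have H2 := hK P C X β₀ k S m D σ h1 h2 hcl h3 h4 h5 h6 h7 h8 h9 hq h10 h11 hcv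
  have H3 := mul_le_mul_of_nonneg_left H2 hlam
  rw [modelFarL_eq_loadL_add_stiffL]
  nlinarith [H1, H3]

/-- (H-q)′ is monotone in its currencies. -/
theorem LocalSeamTransferBoundQ'.mono {C_T C_T' Cχ Cχ' : ℝ} (hT : C_T ≤ C_T') (hχ : Cχ ≤ Cχ')
    (h : LocalSeamTransferBoundQ' cls s lam ℓ μ₀ τ lamQ ϱ b₀ r_S b₁ ϱχ C_T Cχ) :
    LocalSeamTransferBoundQ' cls s lam ℓ μ₀ τ lamQ ϱ b₀ r_S b₁ ϱχ C_T' Cχ' := by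
  obtain ⟨C_H, hH, h⟩ := h
  refine ⟨C_H, hH, fun P C X β₀ k S m D σ h1 h2 hcl h3 h4 h5 h6 h7 h8 h9 hq h10 h11 hcv => ?_⟩
  have key := h P C X β₀ k S m D σ h1 h2 hcl h3 h4 h5 h6 h7 h8 h9 hq h10 h11 hcv
  have hm := shellMassL_nonneg ϱχ D σ P X ϱ C
  have ht := transMassL_nonneg ϱχ D σ P X ϱ C
  nlinarith

/-- ★ THE PRIMED q-CASCADE IN ONE STEP (parametric, one class) at the record dials and currencies `(1/3000000, 1/100000)`. -/
theorem localSeamTransferBoundQ'_record_of_load_shells_geoExch {κ_B κ₂ κ₃ ν₀ η₂ η₃ A_T Aχ c₂ cχ₂ c₃ cχ₃ c' cχ' : ℝ} (hr : r₁ ≤ r₂)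
    (hT : A_T + 1 / 2 * (c₂ + c₃ + c') ≤ 1 / 3000000) (hχ : Aχ + 1 / 2 * (cχ₂ + cχ₃ + cχ') ≤ 1 / 100000)
    (hL : LoadBoundQ' cls (3 / 5) (1 / 3) 3 (1 / 100) (3 / 100) 160 (2 / 5) 3 b₁ 80 r₁ (1 / 2 * (κ_B - κ₂ - κ₃ - ν₀)) A_T Aχ)
    (hN : NearStiffQ' cls (3 / 5) (1 / 3) 3 (1 / 100) (3 / 100) 160 (2 / 5) 3 b₁ 80 r₁ κ_B)
    (hM : MidTrussQ' cls (3 / 5) (1 / 3) 3 (1 / 100) (3 / 100) 160 (2 / 5) 3 b₁ 80 r₁ r₂ κ₂ η₂ c₂ cχ₂)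
    (hF : FarTrussQ' cls (3 / 5) (1 / 3) 3 (1 / 100) (3 / 100) 160 (2 / 5) 3 b₁ 80 r₁ r₂ κ₃ η₃ c₃ cχ₃)
    (hG : GeoExchQ' cls (3 / 5) (1 / 3) 3 (1 / 100) (3 / 100) 160 (2 / 5) 3 b₁ 80 r₁ ν₀ (η₂ + η₃) c' cχ') :
    LocalSeamTransferBoundQ' cls (3 / 5) (1 / 3) 3 (1 / 100) (3 / 100) (1 / 2) 160 (2 / 5) 3 b₁ 80 (1 / 3000000) (1 / 100000) :=
  (localSeamTransferBoundQ'_of_load_of_coercive (by norm_num) hL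
    (coerciveStiffQ'_of_barExch_of_geoExch (barExchQ'_of_nearStiff_of_midTruss_of_farTruss hr hN hM hF) hG)).mono hT hχ

/-- ★ THE PRIMED fcc q-DESIGNATE (numbers of NODE 71): [LOAD-q]′(`3/4`) ∧ [NN](`27/10`) ∧ [MID-q]′(`1/2, 0`) ∧ [FAR-q]′(`11/20, 1/25`) ∧
[GEO♮-q]′(`3/20, 1/25`) ⟹ (H-q)′(`1/3000000, 1/100000`), every class predicate, every floor `b₁`. -/
theorem localSeamTransferBoundQ'_designateF
    (hL : LoadBoundQ' cls (3 / 5) (1 / 3) 3 (1 / 100) (3 / 100) 160 (2 / 5) 3 b₁ 80 (6 / 5) (3 / 4) (3 / 10000000) (9 / 1000000))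
    (hNN : NnStiffCls cls (27 / 10) (6 / 5))
    (hM : MidTrussQ' cls (3 / 5) (1 / 3) 3 (1 / 100) (3 / 100) 160 (2 / 5) 3 b₁ 80 (6 / 5) (3 / 2) (1 / 2) 0 (1 / 60000000) (1 / 2000000))
    (hF : FarTrussQ' cls (3 / 5) (1 / 3) 3 (1 / 100) (3 / 100) 160 (2 / 5) 3 b₁ 80 (6 / 5) (3 / 2) (11 / 20) (1 / 25) (1 / 60000000)
      (1 / 2000000))
    (hG : GeoExchQ' cls (3 / 5) (1 / 3) 3 (1 / 100) (3 / 100) 160 (2 / 5) 3 b₁ 80 (6 / 5) (3 / 20) (1 / 25) (1 / 30000000) (1 / 1000000)) :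
    LocalSeamTransferBoundQ' cls (3 / 5) (1 / 3) 3 (1 / 100) (3 / 100) (1 / 2) 160 (2 / 5) 3 b₁ 80 (1 / 3000000) (1 / 100000) := by
  have e : (1 / 2 : ℝ) * (27 / 10 - 1 / 2 - 11 / 20 - 3 / 20) = 3 / 4 := by norm_num
  have hL' : LoadBoundQ' cls (3 / 5) (1 / 3) 3 (1 / 100) (3 / 100) 160 (2 / 5) 3 b₁ 80 (6 / 5) (1 / 2 * (27 / 10 - 1 / 2 - 11 / 20 - 3 / 20))
      (3 / 10000000) (9 / 1000000) := by rw [e]; exact hL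
  have hG' : GeoExchQ' cls (3 / 5) (1 / 3) 3 (1 / 100) (3 / 100) 160 (2 / 5) 3 b₁ 80 (6 / 5) (3 / 20) (0 + 1 / 25) (1 / 30000000)
      (1 / 1000000) := by
    rw [zero_add]; exact hG
  exact localSeamTransferBoundQ'_record_of_load_shells_geoExch (by norm_num) (by norm_num) (by norm_num) hL'
    (nearStiffQ'_of_nnStiff (by norm_num) hNN) hM hF hG'

/-- ★ THE PRIMED hcp q-DESIGNATE: as fcc with [FAR-q]′(`1/2, 1/40`) and [GEO♮-q]′(`1/5, 1/40`). -/
theorem localSeamTransferBoundQ'_designateH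
    (hL : LoadBoundQ' cls (3 / 5) (1 / 3) 3 (1 / 100) (3 / 100) 160 (2 / 5) 3 b₁ 80 (6 / 5) (3 / 4) (3 / 10000000) (9 / 1000000))
    (hNN : NnStiffCls cls (27 / 10) (6 / 5))
    (hM : MidTrussQ' cls (3 / 5) (1 / 3) 3 (1 / 100) (3 / 100) 160 (2 / 5) 3 b₁ 80 (6 / 5) (3 / 2) (1 / 2) 0 (1 / 60000000) (1 / 2000000))
    (hF : FarTrussQ' cls (3 / 5) (1 / 3) 3 (1 / 100) (3 / 100) 160 (2 / 5) 3 b₁ 80 (6 / 5) (3 / 2) (1 / 2) (1 / 40) (1 / 60000000)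
      (1 / 2000000))
    (hG : GeoExchQ' cls (3 / 5) (1 / 3) 3 (1 / 100) (3 / 100) 160 (2 / 5) 3 b₁ 80 (6 / 5) (1 / 5) (1 / 40) (1 / 30000000) (1 / 1000000)) :
    LocalSeamTransferBoundQ' cls (3 / 5) (1 / 3) 3 (1 / 100) (3 / 100) (1 / 2) 160 (2 / 5) 3 b₁ 80 (1 / 3000000) (1 / 100000) := by
  have e : (1 / 2 : ℝ) * (27 / 10 - 1 / 2 - 1 / 2 - 1 / 5) = 3 / 4 := by norm_num
  have hL' : LoadBoundQ' cls (3 / 5) (1 / 3) 3 (1 / 100) (3 / 100) 160 (2 / 5) 3 b₁ 80 (6 / 5) (1 / 2 * (27 / 10 - 1 / 2 - 1 / 2 - 1 / 5))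
      (3 / 10000000) (9 / 1000000) := by rw [e]; exact hL
  have hG' : GeoExchQ' cls (3 / 5) (1 / 3) 3 (1 / 100) (3 / 100) 160 (2 / 5) 3 b₁ 80 (6 / 5) (1 / 5) (0 + 1 / 40) (1 / 30000000)
      (1 / 1000000) := by
    rw [zero_add]; exact hG
  exact localSeamTransferBoundQ'_record_of_load_shells_geoExch (by norm_num) (by norm_num) (by norm_num) hL'
    (nearStiffQ'_of_nnStiff (by norm_num) hNN) hM hF hG'

end GluePrimed

/-! ## §A4 The octahedral-level glue re-threaded (PROVED): (L) ∧ (Δ) ∧ (Λ)′ ⟹ (K₁ᴴ)′ and (G) ∧ (L) ∧ (K₀) ∧ (K₁ᴴ)′ ∧ (C) ⟹ [MID-q]′ -/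

section OctGluePrimed

variable {cls cls' : Set E3 → Prop} {s lam ℓ μ₀ τ ϱ b₀ r_S b₁ ϱχ r₁ r₂ κ₂ ρlo ρhi c_T cχ : ℝ}

/-- ★★ THE GLUE OF NODE 74, PRIMED: (L) ∧ (Δ) ∧ (Λ)′ ⟹ (K₁ᴴ)′ over the same class (separation `3/5`): (L) and (Δ) are statements for EVERY
invariant list and are used unprimed; the deficit ledger is applied to the admissible list in hand. -/
theorem octShellHQ'_of_dictLedger
    (hL : OctLedgerQ cls (3 / 5) lam ℓ μ₀ τ ϱ b₀ r_S b₁ ϱχ r₁ r₂ κ₂ ρlo ρhi)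
    (hΔ : OctDictQ cls (3 / 5) lam ℓ μ₀ τ ϱ b₀ r_S b₁ ϱχ r₁ r₂ κ₂ ρlo ρhi)
    (hΛ : OctDefLedgerQ' cls (3 / 5) lam ℓ τ ϱ ϱχ r₁ r₂ κ₂ ρlo ρhi c_T cχ) :
    OctShellHQ' cls (3 / 5) lam ℓ μ₀ τ ϱ b₀ r_S b₁ ϱχ r₁ r₂ κ₂ c_T cχ := by
  classical
  obtain ⟨c_H, hc, hΛ⟩ := hΛ
  refine ⟨c_H, hc, fun P C X β₀ k S m D σ h1 h2 hcl h3 h4 h5 h6 h7 h8 h9 hq h10 h11 hcv => ?_⟩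
  obtain ⟨hFr, -⟩ := hL P C X β₀ k S m D σ h1 h2 hcl h3 h4 h5 h6 h7 h8 h9 hq h10 h11
  have eΛ := hΛ P C X m D σ h1 h2 hcl h3 h4 h6 h7 h11 hcv hFr
  have eΔ := hΔ P C X β₀ k S m D σ h1 h2 hcl h3 h4 h5 h6 h7 h8 h9 hq h10 h11 hFr
  have hcmp : -octDefShellL ϱχ D σ κ₂ r₁ r₂ τ P X ϱ C ≤ octShellL ϱχ D σ κ₂ r₁ r₂ (volterraField P S β₀) P X ϱ C := by
    unfold octDefShellL octShellL octSiteWith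
    rw [← Finset.sum_neg_distrib]
    refine Finset.sum_le_sum fun y hy => ?_
    have hyP : y ∈ P.points := P.mem_points_of_mem_motif hy
    have hF := h1.finite_inter_closedBall (by norm_num) y r₂
    set T : Finset E3 := hF.toFinset with hT
    have hmemT : ∀ z, z ∈ P.points → dist y z ≤ r₂ → z ∈ T := fun z hz hd => by
      rw [hT, Set.Finite.mem_toFinset]
      exact ⟨hz, Metric.mem_closedBall.2 (by rw [dist_comm]; exact hd)⟩
    rw [finsum_eq_sum_of_support_subset (s := T), finsum_eq_sum_of_support_subset (s := T)]
    · rw [← Finset.sum_neg_distrib]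
      refine Finset.sum_le_sum fun z _ => ?_
      split_ifs with h
      · have := eΔ y hyP z h.1.1 h.1.2.1 h.1.2.2 h.2.1; linarith
      · simp
    · intro z hz
      by_contra hzT
      exact (Function.mem_support.1 hz) (if_neg fun h' => hzT (hmemT z h'.1.1 h'.1.2.2))
    · intro z hz
      by_contra hzT
      exact (Function.mem_support.1 hz) (if_neg fun h' => hzT (hmemT z h'.1.1 h'.1.2.2))
  linarith

/-- ★★ THE GLUE WITH THE PRICED ONSET PIECE, PRIMED: (G) ∧ (L) ∧ (K₀) ∧ (K₁ᴴ)′ ∧ (C) ⟹ [MID-q]′(`κ₂, η₂ = 0, c_T, cχ`) — (L), (K₀), (C) are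
used unprimed (statements for every invariant list). -/
theorem midTrussQ'_of_octahedralLedgerH (hG : CubicSelect cls cls')
    (hL : OctLedgerQ cls' s lam ℓ μ₀ τ ϱ b₀ r_S b₁ ϱχ r₁ r₂ κ₂ ρlo ρhi)
    (hK : OctPlateauQ cls' s lam ℓ μ₀ τ ϱ b₀ r_S b₁ ϱχ r₁ r₂ κ₂ ρlo ρhi)
    (hSh : OctShellHQ' cls' s lam ℓ μ₀ τ ϱ b₀ r_S b₁ ϱχ r₁ r₂ κ₂ c_T cχ)
    (hC : OctCollarQ cls' s lam ℓ μ₀ τ ϱ b₀ r_S b₁ ϱχ r₁ r₂ κ₂) :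
    MidTrussQ' cls s lam ℓ μ₀ τ ϱ b₀ r_S b₁ ϱχ r₁ r₂ κ₂ 0 c_T cχ := by
  obtain ⟨c₁, hc₁, hSh⟩ := hSh
  obtain ⟨c₂, hc₂, hC⟩ := hC
  refine ⟨c₁ + c₂, add_nonneg hc₁ hc₂, fun P C X β₀ k S m D σ h1 h2 hcl h3 h4 h5 h6 h7 h8 h9 hq h10 h11 hcv => ?_⟩
  have hcl' : cls' P.points := hG P hcl h3 h4
  obtain ⟨hFr, hId⟩ := hL P C X β₀ k S m D σ h1 h2 hcl' h3 h4 h5 h6 h7 h8 h9 hq h10 h11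
  have e1 := hK P C X β₀ k S m D σ h1 h2 hcl' h3 h4 h5 h6 h7 h8 h9 hq h10 h11 hFr
  have e2 := hSh P C X β₀ k S m D σ h1 h2 hcl' h3 h4 h5 h6 h7 h8 h9 hq h10 h11 hcv
  have e3 := hC P C X β₀ k S m D σ h1 h2 hcl' h3 h4 h5 h6 h7 h8 h9 hq h10 h11
  have hs : (c₁ + c₂) * (pricedNearCountL ϱχ D σ P X ϱ C : ℝ) =
      c₁ * (pricedNearCountL ϱχ D σ P X ϱ C : ℝ) + c₂ * (pricedNearCountL ϱχ D σ P X ϱ C : ℝ) := add_mul _ _ _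
  rw [zero_mul, add_zero]
  linarith

end OctGluePrimed

end Summit.AtomisticToContinuum.Crystallization.Theorems.ChargedEnergyGapChartDial
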